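import Summits.Ventures.GridStability.Models.InverterPLLFaultDrift

/-!
# GridStability/Models/InverterPLLFaultDriftUnits — the faulted SRF-PLL closed loop in the dimensionless units of Du et al.'s Eq. (1): `θ̇ = ω`, `ω̇ = I + D ω` (the fault-on stage of #119-cand «G3.d-GFL-CCT-BRACKET», BY NAME)

Cell `gridfusion` (LADDER-GRIDFUSION rung G3.d; seat gridfusion-model-3 (g10); companion of
`Models/InverterPLLFaultDrift.lean` (P24, p549781) and `Models/InverterPLLDuI04CCT.lean` (#119-cand, p557025)).
The fault-on stage declared in `InverterPLLDuI04CCT` — `θ̇ = ω`, `ω̇ = I + D ω` in the units of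
[cite: DuEtAl2024, Eq. (1)] — IS model-3's faulted closed loop (`SrfPll.faulted`: bus voltage `V_e := 0`,
branch `R_g, L_g` and current references held) read through the (P15) dictionary of `InverterPLLClosedLoop`
(`isSolution_genSwingOf`: `τ = σt`, `ω = Ω_b x/σ`, `σ = √(k^i V_e Ω_b/μ)`, `I = (R_g i_q + ω_s L_g i_d)/V_e`,
`D = k^i L_g i_d/(μσ)`, `α = k^p V_e Ω_b/(μσ)`) with the PRE-fault time scale: of the four terms of Eq. (1)
the grid-voltage-proportional ones (restoring `sin θ`, cos-damping `α cos θ·ω`) vanish with the bus voltage,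
while the drive `I` (its `1/V_e` is the scaling's, i.e. the PRE-fault voltage) and the anti-damping `D` stay.
THREE COLUMNS: MODELLED + COMPOSED (MV-6P, MV-INV-3: quasi-static branch, algebraic current loops, no PLL
freeze / LVRT logic); a kernel identity between two typed objects, no numerals; nothing about a device.
-/

noncomputable section

open Real

namespace Summit.Ventures.GridStability.Models.InverterPLL.SrfPll

variable {L : SrfPll} {B : PccBranch}

/-- **The faulted loop in Eq. (1) units.** For `μ = 1 − k^p L_g i_d > 0` and `k^i V_e Ω_b > 0` (PRE-fault
`V_e`): if `(θ, ε)` solves the composed closed loop of the FAULTED record (`V_e := 0`), then the pair rescaled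
with the PRE-fault `σ` — `θ̃(τ) = θ(τ/σ)`, `ω̃(τ) = (Ω_b/σ)·x_fault(τ/σ)` — satisfies `θ̃′ = ω̃` and
`ω̃′ = I + D ω̃` with the PRE-fault dictionary's `I = dimI`, `D = dimD` (the record `genSwingOf B`); from the
locked point its solution is `ω̃(τ) = (I/D)(e^{Dτ} − 1)`, `θ̃ − θˢ = (I/D²)(e^{Dτ} − 1 − Dτ)` — the
closed-form fault-on arc of `InverterPLLDuI04CCT`. MODELLED + COMPOSED. [cite: DuEtAl2024, Eq. (1)] -/
theorem faulted_genSwing_units (hμ : 0 < L.loopFactor B) (hk : 0 < L.ki * B.Ve * L.Ωb)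
    {θ ε : ℝ → ℝ} (h : L.IsClosedLoopSolution (faulted B) θ ε) (τ : ℝ) :
    HasDerivAt (fun s => θ (s / L.sigma B))
        (L.Ωb / L.sigma B * L.freqMismatch (faulted B) (θ (τ / L.sigma B)) (ε (τ / L.sigma B))) τ ∧
      HasDerivAt
        (fun s => L.Ωb / L.sigma B * L.freqMismatch (faulted B) (θ (s / L.sigma B)) (ε (s / L.sigma B)))
        ((L.genSwingOf B).I + (L.genSwingOf B).D *
          (L.Ωb / L.sigma B * L.freqMismatch (faulted B) (θ (τ / L.sigma B)) (ε (τ / L.sigma B)))) τ := by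
  have hrad : 0 < L.ki * B.Ve * L.Ωb / L.loopFactor B := div_pos hk hμ
  have hσ : 0 < L.sigma B := L.sigma_pos B hrad
  have hσ2 := L.sigma_sq B hrad
  have hμ0 : L.loopFactor B ≠ 0 := hμ.ne'
  have hVe : B.Ve ≠ 0 := by
    intro h0
    rw [h0, mul_zero, zero_mul] at hk
    exact lt_irrefl _ hk
  set σ := L.sigma B with hσdef
  have hs : HasDerivAt (fun s => s / σ) (1 / σ) τ := (hasDerivAt_id τ).div_const σ
  constructor
  · have hθ := (hasDerivAt_angle_fault h (τ / σ)).comp τ hs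
    refine hθ.congr_deriv ?_
    ring
  · have hx := ((freqMismatch_fault_deriv hμ0 h (τ / σ)).comp τ hs).const_mul (L.Ωb / σ)
    refine hx.congr_deriv ?_
    simp only [genSwingOf, dimI, dimD]
    rw [← hσdef]
    field_simp
    rw [hσ2]
    field_simp

/-- **Sign and size of the fault-on drift, in the dictionary.** Under the same hypotheses the dimensionless
anti-damping `D` that drives the exponential fault-on runaway `ω̃ = (I/D)(e^{Dτ} − 1)` is positive EXACTLY
when `k^i L_g i_d > 0` (integral gain × grid inductance × ACTIVE current reference) — the physical-units rate
of `InverterPLLFaultDrift` is `r = σ·D` (`faultRate = k^i L_g i_d/μ`). MODELLED + COMPOSED. -/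
theorem faultRate_eq_sigma_mul_dimD (hμ : 0 < L.loopFactor B) (hk : 0 < L.ki * B.Ve * L.Ωb) :
    L.faultRate B = L.sigma B * L.dimD B ∧ (0 < L.dimD B ↔ 0 < L.ki * B.Lg * B.igd) := by
  have hrad : 0 < L.ki * B.Ve * L.Ωb / L.loopFactor B := div_pos hk hμ
  have hσ : 0 < L.sigma B := L.sigma_pos B hrad
  refine ⟨?_, L.dimD_pos_iff B hμ hσ⟩
  unfold faultRate dimD
  field_simp

end Summit.Ventures.GridStability.Models.InverterPLL.SrfPll

end
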